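import Mathlib
import Summits.Ventures.PercRepro2.Defs
import Summits.Ventures.PercRepro2.Graph
import Summits.Ventures.PercRepro2.OneColourSwitch
import Summits.Ventures.PercRepro2.RegionHubSign
import Summits.Ventures.PercRepro2.SideSwitch
import Summits.Ventures.PercRepro2.TermSwitchDefs
import Summits.Ventures.PercRepro2.M9NoPocketDefs
import Summits.Ventures.PercRepro2.M9PsiOneDefs
import Summits.Ventures.PercRepro2.M9PsiOneWorlds
import Summits.Ventures.PercRepro2.M9PsiOneLink
import Summits.Ventures.PercRepro2.M9PsiOneInj
import Summits.Ventures.PercRepro2.M9PsiTwoDefs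
import Summits.Ventures.PercRepro2.M9PsiTwoWorlds
import Summits.Ventures.PercRepro2.M9PsiTwoNoLink
import Summits.Ventures.PercRepro2.M9PsiTwoLink
import Summits.Ventures.PercRepro2.M9PsiTwoUnrooted

/-!
# The direct flipped vertices of `Ψ₂ ω` are visible in the image — the non-pure case (blind
cell PercRepro2, p3 g34, 2026-08-29; `proofs/P3-REST2.md` §1, claim (iv), second step)

In the image `ω' = Ψ₂ ω` the `Y`-core is `Kcore(ω) ∪ R` with `R` the direct flipped vertices.
The BLOCKS of `ω'` (all-edge components of its `Y`-core) lie in `Kcore(ω)` or in `R` (no edge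
joins the two cores).  A block inside `R` is DEAD-JOINED (a vertex with a closed edge to `d`),
`Y`-LINKING, or `W`-adjacent to the unrooted set `Uset ω'` — because the old block of a direct
flipped vertex is all-edge connected and contains a `W`-neighbour of `d` or a linking path —
while a block inside `Kcore(ω)` is none of these (`Rset_psiTwo_eq`, for sources with a
`W`-linking vertex, where `Ψ₂` keeps every edge at `d`).  Own work; std axioms.
-/

namespace Summit.Ventures.PercRepro2

namespace NoPocket

open Finset Classical RegionHub OneColourSwitch SideSwitch TermSwitch

variable {V : Type*} {E : Type*}

section Defs

variable (ends : E → Sym2 V) (r s d : V) (ω' : Config E)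

/-- A `Y`-core vertex of `ω'` is DEAD-JOINED if its block has a closed edge to `d`. -/
def deadJoined (x : V) : Prop :=
  ∃ y ∈ blockIn ends (Kcore ends r s d ω') x, ∃ e, ends e = s(y, d) ∧ ω' e = false

/-- A `Y`-core vertex of `ω'` is `U`-ADJACENT if its block has a closed edge into `Uset ω'`. -/
def adjUset (x : V) : Prop :=
  ∃ y ∈ blockIn ends (Kcore ends r s d ω') x, ∃ u ∈ Uset ends r s d ω', ∃ e,
    ends e = s(y, u) ∧ ω' e = false

/-- The reconstruction of the direct flipped vertices from the image: the `Y`-core vertices of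
`ω'` whose block is dead-joined, `Y`-linking or `U`-adjacent. -/
def Rset : Set V :=
  {x | x ∈ Kcore ends r s d ω' ∧
    (deadJoined ends r s d ω' x ∨ linkingY ends r s d ω' x ∨ adjUset ends r s d ω' x)}

end Defs

section Tools

variable {ends : E → Sym2 V} {r s d : V}

/-- `restrictTo` is monotone in the vertex set. -/
lemma restrictTo_mono {ω : Config E} {S T : Set V} (hST : S ⊆ T) :
    restrictTo ends ω S ≤ restrictTo ends ω T := by
  intro e
  unfold restrictTo
  by_cases hw : e ∈ within ends S
  · obtain ⟨a, ha, b, hb, hab⟩ := hw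
    rw [if_pos ⟨a, ha, b, hb, hab⟩, if_pos ⟨a, hST ha, b, hST hb, hab⟩]
  · rw [if_neg hw]
    simp

/-- `restrictTo` is below the colouring. -/
lemma restrictTo_le {ω : Config E} {S : Set V} : restrictTo ends ω S ≤ ω := by
  intro e
  unfold restrictTo
  split_ifs <;> simp

/-- A vertex of the block of `x` inside `S` with `x ∈ S` lies in `S`. -/
lemma mem_of_mem_blockIn {S : Set V} {x y : V} (hx : x ∈ S) (hy : y ∈ blockIn ends S x) :
    y ∈ S :=
  expl_allIn_subset (H := {x}) (by
    intro z hz; rw [Set.mem_singleton_iff] at hz; rw [hz]; exact hx) ⟨x, rfl, hy⟩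

end Tools

section Rooted

variable {ends : E → Sym2 V} {p q r s d : V} {ω : Config E}

variable (h : IsEX ends p q r s d ω)
include h

/-- The `Y`-core of `Ψ₂ ω` consists of the `Y`-core of `ω` and the direct flipped vertices. -/
lemma Kcore_psiTwo_cases {x : V} (hx : x ∈ Kcore ends r s d (psiTwo ends r s d ω)) :
    x ∈ Kcore ends r s d ω ∨ (x ∈ flipSetW ends r s d ω ∧ directW ends r s d ω x) := by
  obtain ⟨hxK, hxr, hxs, hxd⟩ := hx
  rcases K2_psiTwo_subset h hxK with (hT | hK) | hF
  · simp only [Set.mem_insert_iff, Set.mem_singleton_iff] at hT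
    rcases hT with rfl | rfl | rfl
    · exact (hxr rfl).elim
    · exact (hxs rfl).elim
    · exact (hxd rfl).elim
  · exact Or.inl hK
  · refine Or.inr ⟨hF, ?_⟩
    by_contra hD
    exact not_mem_K2_psiTwo_of_not_directW h hF hD hxK

/-- A `Y`-core vertex of `ω` is a `Y`-core vertex of `Ψ₂ ω`. -/
lemma mem_Kcore_psiTwo_of_mem_Kcore {x : V} (hx : x ∈ Kcore ends r s d ω) :
    x ∈ Kcore ends r s d (psiTwo ends r s d ω) :=
  ⟨mem_K2_psiTwo_of_mem_K2 h hx.1, hx.2.1, hx.2.2.1, hx.2.2.2⟩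

/-- A direct flipped vertex is a `Y`-core vertex of `Ψ₂ ω` (no edge `r–s`). -/
lemma mem_Kcore_psiTwo_of_directW (hrs : ∀ e, ends e ≠ s(r, s)) {x : V}
    (hx : x ∈ flipSetW ends r s d ω) (hd : directW ends r s d ω x) :
    x ∈ Kcore ends r s d (psiTwo ends r s d ω) :=
  ⟨mem_K2_psiTwo_of_directW h hrs hx hd, (flipSetW_subset_Mcore hx).2.1,
    (flipSetW_subset_Mcore hx).2.2.1, (flipSetW_subset_Mcore hx).2.2.2⟩

/-- **The block (in `Ψ₂ ω`) of a `Y`-core vertex of `ω` stays in the `Y`-core of `ω`.** -/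
lemma blockIn_psiTwo_subset_Kcore {x : V} (hx : x ∈ Kcore ends r s d ω) :
    blockIn ends (Kcore ends r s d (psiTwo ends r s d ω)) x ⊆ Kcore ends r s d ω := by
  intro y hy
  have key : y ∈ {z | z ∈ Kcore ends r s d ω} := by
    refine mem_of_conn_of_closed (ends := ends)
      (ω := allIn ends (Kcore ends r s d (psiTwo ends r s d ω))) ?_ hx hy
    intro a ha b hab
    obtain ⟨hne, e, he, hends⟩ := openGraph_adj.1 hab
    unfold allIn at he
    by_cases hw : e ∈ within ends (Kcore ends r s d (psiTwo ends r s d ω))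
    · obtain ⟨u, hu, v, hv, huv⟩ := hw
      have hbK : b ∈ Kcore ends r s d (psiTwo ends r s d ω) := by
        rw [hends, Sym2.eq_iff] at huv
        rcases huv with ⟨_, h2⟩ | ⟨_, h2⟩
        · rw [h2]; exact hv
        · rw [h2]; exact hu
      rcases Kcore_psiTwo_cases h hbK with hb | ⟨hbF, _⟩
      · exact hb
      · exact (no_edge_core_core h ha (flipSetW_subset_Mcore hbF) hends).elim
    · rw [if_neg hw] at he; exact absurd he Bool.false_ne_true
  exact key

/-- **The block (in `Ψ₂ ω`) of a direct flipped vertex stays in the direct flipped vertices.** -/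
lemma blockIn_psiTwo_subset_R {x : V} (hx : x ∈ flipSetW ends r s d ω)
    (hd : directW ends r s d ω x) :
    blockIn ends (Kcore ends r s d (psiTwo ends r s d ω)) x ⊆
      {z | z ∈ flipSetW ends r s d ω ∧ directW ends r s d ω z} := by
  intro y hy
  have key : y ∈ {z | z ∈ flipSetW ends r s d ω ∧ directW ends r s d ω z} := by
    refine mem_of_conn_of_closed (ends := ends)
      (ω := allIn ends (Kcore ends r s d (psiTwo ends r s d ω))) ?_ ⟨hx, hd⟩ hy
    intro a ha b hab
    obtain ⟨hne, e, he, hends⟩ := openGraph_adj.1 hab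
    unfold allIn at he
    by_cases hw : e ∈ within ends (Kcore ends r s d (psiTwo ends r s d ω))
    · obtain ⟨u, hu, v, hv, huv⟩ := hw
      have hbK : b ∈ Kcore ends r s d (psiTwo ends r s d ω) := by
        rw [hends, Sym2.eq_iff] at huv
        rcases huv with ⟨_, h2⟩ | ⟨_, h2⟩
        · rw [h2]; exact hv
        · rw [h2]; exact hu
      rcases Kcore_psiTwo_cases h hbK with hb | hb
      · exact (no_edge_core_core h hb (flipSetW_subset_Mcore ha.1) (ends_swap hends)).elim
      · exact hb
    · rw [if_neg hw] at he; exact absurd he Bool.false_ne_true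
  exact key

/-- On the edges inside a set of `Y`-core vertices of `ω` together with `{r, s}`, `Ψ₂ ω` agrees
with `ω` (no edge `r–s`). -/
lemma psiTwo_eq_on_Kcore {S : Set V} (hS : S ⊆ Kcore ends r s d ω) :
    ∀ e a b, a ≠ b → a ∈ S ∪ {r, s} → b ∈ S ∪ {r, s} → ends e = s(a, b) →
      psiTwo ends r s d ω e = ω e := by
  intro e a b hab ha hb hends
  rcases ha with ha | ha
  · exact psiTwo_Kcore h (hS ha) hends
  · rcases hb with hb | hb
    · exact psiTwo_Kcore h (hS hb) (ends_swap hends)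
    · simp only [Set.mem_insert_iff, Set.mem_singleton_iff] at ha hb
      exact psiTwo_term_term h ha hb hends

/-- **A `Y`-core vertex of `ω` is not in the reconstruction set** (no edge `r–s`, `r ≁_Y s`). -/
lemma not_mem_Rset_of_mem_Kcore (hrs : ∀ e, ends e ≠ s(r, s)) (hY : ¬ Conn ends ω r s) {x : V}
    (hx : x ∈ Kcore ends r s d ω) : x ∉ Rset ends r s d (psiTwo ends r s d ω) := by
  rintro ⟨_, hdead | hlink | hadj⟩
  · -- a closed edge to `d` from a `Y`-core vertex of `ω`: impossible (`F2`)
    obtain ⟨y, hy, e, hends, he⟩ := hdead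
    have hyK := blockIn_psiTwo_subset_Kcore h hx hy
    rw [psiTwo_d_Kcore h hyK (ends_swap hends), edge_Kcore_d h hyK hends] at he
    exact Bool.false_ne_true he.symm
  · -- a `Y`-link inside a block of the `Y`-core of `ω`: a `Y`-link of `ω`
    have hsub := blockIn_psiTwo_subset_Kcore h hx
    have hc : Conn ends (restrictTo ends ω
        (blockIn ends (Kcore ends r s d (psiTwo ends r s d ω)) x ∪ {r, s})) r s :=
      conn_restrictTo_transfer (fun e a b hab ha hb hends =>
        (psiTwo_eq_on_Kcore h hsub e a b hab ha hb hends)) hlink.2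
    exact hY (conn_mono restrictTo_le hc)
  · -- a closed edge from a `Y`-core vertex of `ω` into the `W`-core: impossible (`F1`)
    obtain ⟨y, hy, u, hu, e, hends, _⟩ := hadj
    have hyK := blockIn_psiTwo_subset_Kcore h hx hy
    have huM : u ∈ Mcore ends r s d ω := flipSetW_subset_Mcore (Uset_psiTwo_subset h hrs hu).1
    exact no_edge_core_core h hyK huM hends

/-- **The old block of a direct flipped vertex lies in its image block, unless the image block
is `U`-adjacent** (no edge `r–s`). -/
lemma blockIn_subset_or_adjUset (hrs : ∀ e, ends e ≠ s(r, s)) {x : V}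
    (hx : x ∈ flipSetW ends r s d ω) (hd : directW ends r s d ω x) :
    adjUset ends r s d (psiTwo ends r s d ω) x ∨
      blockIn ends (Mcore ends r s d ω) x ⊆
        blockIn ends (Kcore ends r s d (psiTwo ends r s d ω)) x := by
  by_cases hna : adjUset ends r s d (psiTwo ends r s d ω) x
  · exact Or.inl hna
  right
  set Q := blockIn ends (Kcore ends r s d (psiTwo ends r s d ω)) x with hQ
  intro y hy
  have key : y ∈ {z | z ∈ Q} := by
    refine mem_of_conn_of_closed (ends := ends) (ω := allIn ends (Mcore ends r s d ω)) ?_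
      (mem_blockIn_self _ _) hy
    intro a ha b hab
    obtain ⟨hne, e, he, hends⟩ := openGraph_adj.1 hab
    unfold allIn at he
    by_cases hw : e ∈ within ends (Mcore ends r s d ω)
    · obtain ⟨u, hu, v, hv, huv⟩ := hw
      have hbM : b ∈ Mcore ends r s d ω := by
        rw [hends, Sym2.eq_iff] at huv
        rcases huv with ⟨_, h2⟩ | ⟨_, h2⟩
        · rw [h2]; exact hv
        · rw [h2]; exact hu
      have haR := blockIn_psiTwo_subset_R h hx hd ha
      have hbF : b ∈ flipSetW ends r s d ω := mem_flipSetW_of_edge haR.1 hbM hends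
      by_cases hbD : directW ends r s d ω b
      · have hbK := mem_Kcore_psiTwo_of_directW h hrs hbF hbD
        have haK := mem_Kcore_psiTwo_of_directW h hrs haR.1 haR.2
        exact conn_trans ha (conn_allIn_of_edge haK hbK hends)
      · exfalso
        have hω : ω e = true := by
          cases hc : ω e
          · exact (hbD (directW_of_edge haR.2 hbM hends hc)).elim
          · rfl
        refine hna ⟨a, ha, b, mem_Uset_psiTwo_of_not_directW h hbF hbD, e, hends, ?_⟩
        rw [psiTwo_inside haR.1 hends hbM, hω]
        rfl
    · rw [if_neg hw] at he; exact absurd he Bool.false_ne_true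
  exact key

/-- **A direct flipped vertex is in the reconstruction set** — the non-pure case (no edge
`r–s`, some `W`-linking vertex). -/
lemma mem_Rset_of_directW (hrs : ∀ e, ends e ≠ s(r, s)) (hp : ¬ PureW ends r s d ω) {x : V}
    (hx : x ∈ flipSetW ends r s d ω) (hd : directW ends r s d ω x) :
    x ∈ Rset ends r s d (psiTwo ends r s d ω) := by
  refine ⟨mem_Kcore_psiTwo_of_directW h hrs hx hd, ?_⟩
  rcases blockIn_subset_or_adjUset h hrs hx hd with hadj | hold
  · exact Or.inr (Or.inr hadj)
  rcases hx with hxJ | hxL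
  · -- joined: a `W`-core neighbour of `d` lies in the old block, hence in the image block,
    -- with its `d`-edge kept closed
    obtain ⟨y₀, ⟨hy₀M, e₀, hends₀⟩, hc₀⟩ := hxJ
    have hy₀Q := hold (conn_symm hc₀)
    refine Or.inl ⟨y₀, hy₀Q, e₀, ends_swap hends₀, ?_⟩
    rw [psiTwo_d_of_not_pure hends₀ hp]
    exact edge_Mcore_d h hy₀M (ends_swap hends₀)
  · -- linking: the `W`-link inside the old block is a `Y`-link of `Ψ₂ ω` inside the image block
    refine Or.inr (Or.inl ⟨mem_Kcore_psiTwo_of_directW h hrs (Or.inr hxL) hd, ?_⟩)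
    have hc : Conn ends (restrictTo ends (psiTwo ends r s d ω)
        (blockIn ends (Mcore ends r s d ω) x ∪ {r, s})) r s :=
      conn_restrictTo_transfer (psiTwo_eq_not_on_block h hrs (Or.inr hxL)) hxL.2
    exact conn_mono (restrictTo_mono (Set.union_subset_union_left _ hold)) hc

/-- **The reconstruction set of the image is the set of direct flipped vertices** — the
non-pure case (no edge `r–s`, `r ≁_Y s`, some `W`-linking vertex). -/
theorem Rset_psiTwo_eq (hrs : ∀ e, ends e ≠ s(r, s)) (hY : ¬ Conn ends ω r s)
    (hp : ¬ PureW ends r s d ω) :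
    Rset ends r s d (psiTwo ends r s d ω) =
      {z | z ∈ flipSetW ends r s d ω ∧ directW ends r s d ω z} := by
  ext x
  constructor
  · intro hx
    rcases Kcore_psiTwo_cases h hx.1 with hK | hR
    · exact (not_mem_Rset_of_mem_Kcore h hrs hY hK hx).elim
    · exact hR
  · rintro ⟨hxF, hxD⟩
    exact mem_Rset_of_directW h hrs hp hxF hxD

end Rooted

end NoPocket

end Summit.Ventures.PercRepro2
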